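import Summits.AtomisticToContinuum.Crystallization.Theorems.ChargedEnergyGapSourceKernel
import HarnessLib

/-!
# Charged energy gap — lens-3 g65, node «BarlowRef» (R3) — part 22a (addendum; imports part 18): the FAR-SOURCE KERNEL in closed form

Critic row 1224 (g65 agenda, first item): the per-band `TubeShareBoundH` certificate (HANDOFF g65 item 2) must contain NO numerical
truncation of the tube sources `y`.  Parts 22a/22b bound, ONCE AND FOR ALL LEVELS, the contribution to `tubeLoad r c F G` of the sources at
distance `≥ A` from the tube centre `c` (`A − r ≥ 18/5`), in CLOSED FORM, with both cell volumes multiplied in.  This file: ONE far source.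

* `inv_pow_ratio_lt_one`, `geom_sum_inv_pow_le` — geometric series in `q⁻¹` (`q > 1`);
* `far_class_arith` — the pure arithmetic of one thickened class;
* `farPsiCore`, `farPsi = π · farPsiCore` — the per-source constant (`farPsiCore_nonneg`, `farPsi_nonneg`, record value
  `farPsiCore_record_le : farPsiCore (101/5) (1899/5) (11/10) 40 ≤ 258.2`, i.e. `farPsi ≤ 811.2`);
* ★ `far_source_kernel_mul_le`: for ONE source `y` with `X ≤ dist y c − r` (`X ≥ 18/5`), any finite `T ⊆` image, any `q > 1`, `K`:
  `(Σ_{z ∈ T} [y ≠ z ∧ infDist c [y,z] ≤ r]·(dist y z)⁻⁶) · V ≤ farPsi r X q K · (dist y c − r)⁻⁵`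
  — part 18 `source_kernel_mul_le` with the geometric classes `α k = (dist y c − r)·qᵏ`, the shadow-cone slope `κ = r/(dist y c − r)`
  (`κ²((x + r)² − r²) = r² + 2r³/x ≥ r²`), every class thickened to a cylinder by part 16 `coneVol_le_cylinder`
  (class term `≤ π((q − 1) + (18/5)/X)(rq + M)²·x⁻⁵·q⁻³ᵏ`, `M = (2r/X + 1)·9/5`), the classes summed as a geometric series (`1/(1 − q⁻³)`),
  part 16's cone tail beyond class `K` (`(128π/7) r² x⁻⁵ q⁻³ᴷ + (128π/31) M² x⁻⁵ q⁻⁵ᴷ`); the start `α 0 ≤ axial` is part 18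
  `sub_le_axial_of_test` with §R7 `exists_mem_segment_dist_le`.

The double sum over far sources, the record `≤ 3/50` and the statistic-currency share are part 22b (`…FarSourceTail`).
0 sorry; standard axioms.
-/

noncomputable section

open scoped Classical RealInnerProductSpace
open Literature.MathematicalPhysics.StatisticalMechanics Literature.Geometry.DiscreteGeometry
open Summit.AtomisticToContinuum.Crystallization.Theses.PricedLinkCensus
open Summit.AtomisticToContinuum.Crystallization.Theorems.ChargedEnergyGapNegative

namespace Summit.AtomisticToContinuum.Crystallization.Theorems.ChargedEnergyGapChartDial

section FarSourceKernel

/-- The ratio of a geometric series in `q⁻¹`: `0 ≤ (q⁻¹)^m < 1` for `q > 1`, `m ≠ 0`. -/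
theorem inv_pow_ratio_lt_one {q : ℝ} (hq : 1 < q) {m : ℕ} (hm : m ≠ 0) : 0 ≤ (q⁻¹) ^ m ∧ (q⁻¹) ^ m < 1 := by
  have hq0 : 0 < q := one_pos.trans hq
  have h1 : 0 ≤ q⁻¹ := inv_nonneg.2 hq0.le
  have h2 : q⁻¹ < 1 := inv_lt_one_of_one_lt₀ hq
  exact ⟨pow_nonneg h1 m, pow_lt_one₀ h1 h2 hm⟩

/-- Geometric sums in `q⁻¹`: `Σ_{i<N} ((q⁻¹)^m)^i ≤ 1/(1 − (q⁻¹)^m)` (`q > 1`, `m ≠ 0`). -/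
theorem geom_sum_inv_pow_le {q : ℝ} (hq : 1 < q) {m : ℕ} (hm : m ≠ 0) (N : ℕ) :
    ∑ i ∈ Finset.range N, ((q⁻¹) ^ m) ^ i ≤ 1 / (1 - (q⁻¹) ^ m) := by
  obtain ⟨h0, h1⟩ := inv_pow_ratio_lt_one hq hm
  have h := geom_sum_Ico_le_of_lt_one (m := 0) (n := N) h0 h1
  rwa [pow_zero, ← Finset.range_eq_Ico] at h

/-- ONE FAR CLASS, pure arithmetic (`x ≥ X ≥ 18/5`, `r ≥ 0`, `q ≥ 1`, `t = qᵏ ≥ 1`): the cylinder over the class `[xt − 9/5, xqt + 9/5]`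
with slope `r/x` and margin `(r/x + 1)·9/5`, weighted by `(xt)⁻⁶`, is at most `π((q − 1) + (18/5)/X)(rq + (2r/X + 1)·9/5)² · x⁻⁵ · t⁻³`. -/
theorem far_class_arith {x r q X t : ℝ} (hX : 18 / 5 ≤ X) (hx : X ≤ x) (hr : 0 ≤ r) (hq : 1 ≤ q) (ht : 1 ≤ t) :
    Real.pi * (x * q * t + 9 / 5 - (x * t - 9 / 5)) * (r / x * (x * q * t + 9 / 5) + (r / x + 1) * (9 / 5)) ^ 2 * (x * t)⁻¹ ^ 6 ≤
      Real.pi * ((q - 1) + 18 / 5 / X) * (r * q + (2 * r / X + 1) * (9 / 5)) ^ 2 * x⁻¹ ^ 5 * t⁻¹ ^ 3 := by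
  have hX0 : 0 < X := by linarith
  have hx0 : 0 < x := hX0.trans_le hx
  have ht0 : 0 < t := one_pos.trans_le ht
  have hπ := Real.pi_pos.le
  have hq0 : 0 ≤ q - 1 := sub_nonneg.2 hq
  -- the width of the thickened class
  have hw : x * q * t + 9 / 5 - (x * t - 9 / 5) ≤ (x * (q - 1) + 18 / 5) * t := by nlinarith
  have hC0 : 0 ≤ (x * (q - 1) + 18 / 5) * t := by positivity
  -- the radius of the cylinder
  have hρe : r / x * (x * q * t + 9 / 5) + (r / x + 1) * (9 / 5) = r * q * t + (2 * (r / x) + 1) * (9 / 5) := by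
    field_simp
    ring
  have hrx : r / x ≤ r / X := div_le_div_of_nonneg_left hr hX0 hx
  have hM0 : 0 ≤ (2 * r / X + 1) * (9 / 5) := by positivity
  have hρ : r / x * (x * q * t + 9 / 5) + (r / x + 1) * (9 / 5) ≤ (r * q + (2 * r / X + 1) * (9 / 5)) * t := by
    rw [hρe]
    have h1 : (2 * (r / x) + 1) * (9 / 5) ≤ (2 * r / X + 1) * (9 / 5) := by
      have : 2 * (r / x) ≤ 2 * r / X := by rw [mul_div_assoc]; linarith
      linarith
    nlinarith
  have hρ0 : 0 ≤ r / x * (x * q * t + 9 / 5) + (r / x + 1) * (9 / 5) := by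
    have : 0 ≤ r / x := div_nonneg hr hx0.le
    have : 0 ≤ x * q * t + 9 / 5 := by positivity
    positivity
  have hsq : (r / x * (x * q * t + 9 / 5) + (r / x + 1) * (9 / 5)) ^ 2 ≤ ((r * q + (2 * r / X + 1) * (9 / 5)) * t) ^ 2 :=
    pow_le_pow_left₀ hρ0 hρ 2
  -- the key decay: `(x(q−1) + 18/5)·x⁻⁶ ≤ ((q−1) + (18/5)/X)·x⁻⁵`
  have hinv : x⁻¹ ≤ X⁻¹ := inv_anti₀ hX0 hx
  have hx5 : 0 ≤ x⁻¹ ^ 5 := by positivity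
  have hkey : (x * (q - 1) + 18 / 5) * x⁻¹ ^ 6 ≤ ((q - 1) + 18 / 5 / X) * x⁻¹ ^ 5 := by
    have hxu : x * x⁻¹ = 1 := mul_inv_cancel₀ hx0.ne'
    have e : (x * (q - 1) + 18 / 5) * x⁻¹ ^ 6 = (q - 1) * x⁻¹ ^ 5 + 18 / 5 * x⁻¹ * x⁻¹ ^ 5 := by
      linear_combination (q - 1) * x⁻¹ ^ 5 * hxu
    have e' : ((q - 1) + 18 / 5 / X) * x⁻¹ ^ 5 = (q - 1) * x⁻¹ ^ 5 + 18 / 5 * X⁻¹ * x⁻¹ ^ 5 := by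
      rw [div_eq_mul_inv (18 / 5 : ℝ) X]
      ring
    rw [e, e']
    have : 18 / 5 * x⁻¹ * x⁻¹ ^ 5 ≤ 18 / 5 * X⁻¹ * x⁻¹ ^ 5 := by gcongr
    linarith
  have hB0 : 0 ≤ Real.pi * (r * q + (2 * r / X + 1) * (9 / 5)) ^ 2 * t⁻¹ ^ 3 := by positivity
  calc Real.pi * (x * q * t + 9 / 5 - (x * t - 9 / 5)) * (r / x * (x * q * t + 9 / 5) + (r / x + 1) * (9 / 5)) ^ 2 * (x * t)⁻¹ ^ 6
      ≤ Real.pi * ((x * (q - 1) + 18 / 5) * t) * ((r * q + (2 * r / X + 1) * (9 / 5)) * t) ^ 2 * (x * t)⁻¹ ^ 6 := by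
        have h1 : Real.pi * (x * q * t + 9 / 5 - (x * t - 9 / 5)) ≤ Real.pi * ((x * (q - 1) + 18 / 5) * t) :=
          mul_le_mul_of_nonneg_left hw hπ
        have h2 := mul_le_mul h1 hsq (sq_nonneg _) (mul_nonneg hπ hC0)
        exact mul_le_mul_of_nonneg_right h2 (by positivity)
    _ = Real.pi * (r * q + (2 * r / X + 1) * (9 / 5)) ^ 2 * t⁻¹ ^ 3 * ((x * (q - 1) + 18 / 5) * x⁻¹ ^ 6) := by
        have hxne : x ≠ 0 := hx0.ne'
        have htne : t ≠ 0 := ht0.ne'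
        field_simp
        try ring
    _ ≤ Real.pi * (r * q + (2 * r / X + 1) * (9 / 5)) ^ 2 * t⁻¹ ^ 3 * (((q - 1) + 18 / 5 / X) * x⁻¹ ^ 5) :=
        mul_le_mul_of_nonneg_left hkey hB0
    _ = Real.pi * ((q - 1) + 18 / 5 / X) * (r * q + (2 * r / X + 1) * (9 / 5)) ^ 2 * x⁻¹ ^ 5 * t⁻¹ ^ 3 := by ring

/-- The rational core of the FAR-SOURCE constant: classes `q`-geometric up to `K`, summed; cone tail beyond class `K`
(`M = (2r/X + 1)·9/5` bounds the class margin). -/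
def farPsiCore (r X q : ℝ) (K : ℕ) : ℝ :=
  ((q - 1) + 18 / 5 / X) * (r * q + (2 * r / X + 1) * (9 / 5)) ^ 2 / (1 - (q⁻¹) ^ 3) +
    128 / 7 * r ^ 2 * (q⁻¹) ^ (3 * K) + 128 / 31 * ((2 * r / X + 1) * (9 / 5)) ^ 2 * (q⁻¹) ^ (5 * K)

/-- The FAR-SOURCE constant `farPsi r X q K = π · farPsiCore r X q K`: `(tube-tested Σ d⁻⁶ of one source) · V ≤ farPsi · (dist y c − r)⁻⁵`. -/
def farPsi (r X q : ℝ) (K : ℕ) : ℝ := Real.pi * farPsiCore r X q K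

/-- `farPsiCore ≥ 0` (`q > 1`, `X > 0`, `r ≥ 0`). -/
theorem farPsiCore_nonneg {r X q : ℝ} (K : ℕ) (hr : 0 ≤ r) (hX : 0 < X) (hq : 1 < q) : 0 ≤ farPsiCore r X q K := by
  obtain ⟨h30, h31⟩ := inv_pow_ratio_lt_one hq (m := 3) (by norm_num)
  have hq0 : 0 ≤ q⁻¹ := inv_nonneg.2 (zero_le_one.trans hq.le)
  have h1 : 0 < 1 - (q⁻¹) ^ 3 := by linarith
  have h2 : 0 ≤ (q - 1) + 18 / 5 / X := by have := sub_nonneg.2 hq.le; positivity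
  unfold farPsiCore
  positivity

/-- `farPsi ≥ 0`. -/
theorem farPsi_nonneg {r X q : ℝ} (K : ℕ) (hr : 0 ≤ r) (hX : 0 < X) (hq : 1 < q) : 0 ≤ farPsi r X q K :=
  mul_nonneg Real.pi_pos.le (farPsiCore_nonneg K hr hX hq)

/-- ★ THE FAR-SOURCE KERNEL (one source, closed form).  For a source `y` with `X ≤ dist y c − r` (`X ≥ 18/5`, `r ≥ 0`), any finite
`T ⊆` image, any ratio `q > 1` and depth `K`:
`(Σ_{z ∈ T} [y ≠ z ∧ infDist c [y,z] ≤ r]·(dist y z)⁻⁶) · a(a√3/2)h ≤ farPsi r X q K · (dist y c − r)⁻⁵`. -/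
theorem far_source_kernel_mul_le {a h : ℝ} {s : ℤ → ℤ} {g : E3 → E3}
    (ha : 9 / 10 ≤ a ∧ a ≤ 11 / 10) (hh : 0 < h ∧ 27 / 50 * a ^ 2 ≤ h ^ 2 ∧ h ^ 2 ≤ 121 / 150 * a ^ 2) (hg : Isometry g)
    {y c : E3} {r X q : ℝ} (K : ℕ) (hr : 0 ≤ r) (hX : 18 / 5 ≤ X) (hq : 1 < q) (hx : X ≤ dist y c - r)
    (T : Finset E3) (hT : ↑T ⊆ g '' barlowStacking a h s) :
    (∑ z ∈ T, if y ≠ z ∧ Metric.infDist c (segment ℝ y z) ≤ r then (dist y z)⁻¹ ^ 6 else 0) * (a * (a * √3 / 2) * h) ≤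
      farPsi r X q K * (dist y c - r)⁻¹ ^ 5 := by
  have hX0 : 0 < X := by linarith
  set x := dist y c - r with hxdef
  have hx0 : 0 < x := hX0.trans_le hx
  have hry : r < dist y c := by linarith
  have hyc : y ≠ c := fun h0 => by rw [h0, dist_self] at hry; linarith
  obtain ⟨b, hb⟩ := exists_orthonormalBasis_axis hyc
  have hq1 : 1 ≤ q := hq.le
  have hq0 : 0 < q := one_pos.trans hq
  -- the shadow-cone slope and the geometric classes
  set κ := r / x with hκdef
  have hκ : 0 ≤ κ := div_nonneg hr hx0.le
  have hdx : dist y c = x + r := by rw [hxdef]; ring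
  have hκr : r ^ 2 ≤ κ ^ 2 * (dist y c ^ 2 - r ^ 2) := by
    rw [hdx, hκdef, div_pow, show (x + r) ^ 2 - r ^ 2 = x ^ 2 + 2 * x * r by ring, div_mul_eq_mul_div,
      le_div_iff₀ (by positivity)]
    nlinarith [mul_nonneg (mul_nonneg hx0.le hr) (sq_nonneg r)]
  set α : ℕ → ℝ := fun k => x * q ^ k with hαdef
  have hmono : ∀ k, α k ≤ α (k + 1) := fun k => by
    show x * q ^ k ≤ x * q ^ (k + 1)
    rw [pow_succ]
    nlinarith [pow_pos hq0 k, mul_pos hx0 (pow_pos hq0 k)]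
  have hα0 : 0 < α 0 := by show 0 < x * q ^ 0; rw [pow_zero, mul_one]; exact hx0
  have hαK : 18 / 5 ≤ α K := by
    show 18 / 5 ≤ x * q ^ K
    have h1 : (1 : ℝ) ≤ q ^ K := one_le_pow₀ hq1
    nlinarith [hX.trans hx]
  have hstart : ∀ z ∈ T, y ≠ z → Metric.infDist c (segment ℝ y z) ≤ r → α 0 ≤ ⟪b 2, z - y⟫ := by
    intro z _ _ hinf
    obtain ⟨p, hp, hpc⟩ := exists_mem_segment_dist_le hinf
    have h1 := sub_le_axial_of_test hb hp hpc hry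
    show x * q ^ 0 ≤ ⟪b 2, z - y⟫
    rw [pow_zero, mul_one, hxdef]
    exact h1
  have hTy : ∀ z ∈ T, y ≠ z → Metric.infDist c (segment ℝ y z) ≤ r → (0 : ℝ) ≤ dist y z := fun _ _ _ _ => dist_nonneg
  have hmain := source_kernel_mul_le ha hh hg hb hr hry hκ hκr α K hmono hα0 hαK T hT hstart hTy
  refine hmain.trans ?_
  -- the margin of every class is at most `M`
  have hM0 : 0 ≤ (2 * r / X + 1) * (9 / 5) := by positivity
  have hm'M : (2 * κ + 1) * (9 / 5) ≤ (2 * r / X + 1) * (9 / 5) := by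
    have h1 : κ ≤ r / X := div_le_div_of_nonneg_left hr hX0 hx
    have h2 : 2 * κ ≤ 2 * r / X := by rw [mul_div_assoc]; linarith
    linarith
  have hm'0 : 0 ≤ (2 * κ + 1) * (9 / 5) := by positivity
  -- the classes
  set C := Real.pi * ((q - 1) + 18 / 5 / X) * (r * q + (2 * r / X + 1) * (9 / 5)) ^ 2 * x⁻¹ ^ 5 with hC
  have hC0 : 0 ≤ C := by
    have : 0 ≤ (q - 1) + 18 / 5 / X := by have := sub_nonneg.2 hq1; positivity
    positivity
  have hclass : ∀ k ∈ Finset.range K,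
      coneVol κ ((κ + 1) * (9 / 5)) (α k - 9 / 5) (α (k + 1) + 9 / 5) * (max (α k) 0)⁻¹ ^ 6 ≤ C * ((q⁻¹) ^ 3) ^ k := by
    intro k _
    have hqk : 1 ≤ q ^ k := one_le_pow₀ hq1
    have hαk : 0 < α k := mul_pos hx0 (by positivity)
    rw [max_eq_left hαk.le]
    have hμ0 : 0 ≤ (κ + 1) * (9 / 5) := by positivity
    have habs : |α k - 9 / 5| ≤ α (k + 1) + 9 / 5 := by
      rw [abs_le]
      constructor
      · linarith [hmono k]
      · linarith [hmono k]
    have hcyl := coneVol_le_cylinder hκ hμ0 habs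
    have hw6 : 0 ≤ (α k)⁻¹ ^ 6 := by positivity
    refine (mul_le_mul_of_nonneg_right hcyl hw6).trans ?_
    have harith := far_class_arith (r := r) (q := q) (t := q ^ k) hX hx hr hq1 hqk
    have e1 : α (k + 1) = x * q * q ^ k := by show x * q ^ (k + 1) = x * q * q ^ k; rw [pow_succ]; ring
    have e2 : α k = x * q ^ k := rfl
    have e3 : ((q⁻¹) ^ 3) ^ k = (q ^ k)⁻¹ ^ 3 := by rw [← inv_pow, ← pow_mul, ← pow_mul, Nat.mul_comm 3 k]
    rw [e1, e2, e3, hC, hκdef]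
    exact harith
  -- the cone tail beyond class `K`
  have hαKe : α K = x * q ^ K := rfl
  have hqK : 0 < q ^ K := pow_pos hq0 K
  have hxne : x ≠ 0 := hx0.ne'
  have hqKne : q ^ K ≠ 0 := hqK.ne'
  have htail1 : 128 * Real.pi / 7 * κ ^ 2 / α K ^ 3 = Real.pi * (128 / 7 * r ^ 2 * (q⁻¹) ^ (3 * K)) * x⁻¹ ^ 5 := by
    rw [hαKe, hκdef, show (q⁻¹) ^ (3 * K) = ((q ^ K) ^ 3)⁻¹ by rw [inv_pow, pow_mul']]
    field_simp
    try ring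
  have htail2 : 128 * Real.pi / 31 * ((2 * κ + 1) * (9 / 5)) ^ 2 / α K ^ 5 ≤
      Real.pi * (128 / 31 * ((2 * r / X + 1) * (9 / 5)) ^ 2 * (q⁻¹) ^ (5 * K)) * x⁻¹ ^ 5 := by
    have e : 128 * Real.pi / 31 * ((2 * κ + 1) * (9 / 5)) ^ 2 / α K ^ 5 =
        Real.pi * (128 / 31 * ((2 * κ + 1) * (9 / 5)) ^ 2 * (q⁻¹) ^ (5 * K)) * x⁻¹ ^ 5 := by
      rw [hαKe, show (q⁻¹) ^ (5 * K) = ((q ^ K) ^ 5)⁻¹ by rw [inv_pow, pow_mul']]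
      field_simp
      try ring
    rw [e]
    have h1 : ((2 * κ + 1) * (9 / 5)) ^ 2 ≤ ((2 * r / X + 1) * (9 / 5)) ^ 2 := pow_le_pow_left₀ hm'0 hm'M 2
    have h2 : 0 ≤ (q⁻¹) ^ (5 * K) := by positivity
    have h3 : 0 ≤ x⁻¹ ^ 5 := by positivity
    have h4 : 128 / 31 * ((2 * κ + 1) * (9 / 5)) ^ 2 * (q⁻¹) ^ (5 * K) ≤
        128 / 31 * ((2 * r / X + 1) * (9 / 5)) ^ 2 * (q⁻¹) ^ (5 * K) := by gcongr
    exact mul_le_mul_of_nonneg_right (mul_le_mul_of_nonneg_left h4 Real.pi_pos.le) h3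
  -- sum the classes
  have hgeom := geom_sum_inv_pow_le hq (m := 3) (by norm_num) K
  have hsum : ∑ k ∈ Finset.range K, coneVol κ ((κ + 1) * (9 / 5)) (α k - 9 / 5) (α (k + 1) + 9 / 5) * (max (α k) 0)⁻¹ ^ 6 ≤
      C * (1 / (1 - (q⁻¹) ^ 3)) := by
    calc ∑ k ∈ Finset.range K, coneVol κ ((κ + 1) * (9 / 5)) (α k - 9 / 5) (α (k + 1) + 9 / 5) * (max (α k) 0)⁻¹ ^ 6
        ≤ ∑ k ∈ Finset.range K, C * ((q⁻¹) ^ 3) ^ k := Finset.sum_le_sum hclass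
      _ = C * ∑ k ∈ Finset.range K, ((q⁻¹) ^ 3) ^ k := by rw [Finset.mul_sum]
      _ ≤ C * (1 / (1 - (q⁻¹) ^ 3)) := mul_le_mul_of_nonneg_left hgeom hC0
  have hfinal : C * (1 / (1 - (q⁻¹) ^ 3)) + (Real.pi * (128 / 7 * r ^ 2 * (q⁻¹) ^ (3 * K)) * x⁻¹ ^ 5 +
      Real.pi * (128 / 31 * ((2 * r / X + 1) * (9 / 5)) ^ 2 * (q⁻¹) ^ (5 * K)) * x⁻¹ ^ 5) = farPsi r X q K * x⁻¹ ^ 5 := by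
    rw [hC]
    unfold farPsi farPsiCore
    ring
  rw [← hfinal, htail1]
  linarith [hsum, htail2]

/-- RECORD CONSTANTS (`r = 101/5`, `A = 400`, `p = q = 11/10`, `K = 40`): `farPsiCore ≤ 258.2` (`farPsi ≤ 811.2`). -/
theorem farPsiCore_record_le : farPsiCore (101 / 5) (1899 / 5) (11 / 10) 40 ≤ 2582 / 10 := by
  unfold farPsiCore
  norm_num


end FarSourceKernel

end Summit.AtomisticToContinuum.Crystallization.Theorems.ChargedEnergyGapChartDial

end
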